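import Literature.AlgebraicGeometry.Motives.HodgeStructureLefschetzGroupUnitarySplitting
import Literature.LinearAlgebra.Matrix.MatrixAlgebraModuleCorner
import HarnessLib

/-!
# Milne 1999 §2, types II and III on points: for `E_φ = ⟨ι(F), β⟩` with `βι(a) = ι(σa)β`, `β² = ι(b)` (`b ≠ 0`),
# `S(H)(K) ≅ ∏_{s ∈ Φ} Aut(V_{K,τₛ}, B_{τₛ})`, `B_{τₛ}(x, y) = Q_K(x, βy)` — "`γ ↦ γ|V_{σ₁}` identifies
# `U(φ_{1,σ}) ∩ Sp(φ_{2,σ})` with `Sp(φ_{2,σ₁})`" (type II: `B` alternating) / "`≅ ∏ O(φ_{2,σ₁})`" (type III: `B` symmetric)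

[topic AlgebraicGeometry/Motives]

Layer `Literature/AlgebraicGeometry/Motives`, lane `lit-hodgefound` (Track 2 foundations library; seat `lit-hodgefound-p34`,
generation 22, self-proposed row g22-#2; free pointer (j) of the seat sheet: "types II/III on the Hodge-structure side").
Milne computes the Lefschetz group of a simple abelian variety of type II / III NOT by Morita theory but through the maximal
subfield `L = F[α]` of the quaternion algebra `E = L·1 ⊕ L·β`: `S(A) = U(φ₁) ∩ Sp(φ₂)` and, over `k^al`, Remark 2.2 for the
quadratic étale algebras `L ⊗_{F,σ} k^al` pair by pair. This file is that argument on the abstract polarized `ℚ`-Hodge structure,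
on `K`-points, on top of the seat's g21-#1 (`Deligne1982/InvolutionPairedWeightSpaces`: `formUnitaryGroup` = `U(φ₁)(K)`,
`formUnitaryGroupEquiv`) and its FILE 2 (`Motives/HodgeStructureLefschetzGroupUnitarySplitting`: the perfect pairing of the
partner blocks, equal dimensions): definitions WITH BODIES (`Polarization.twistedBlockForm` = Milne's `φ_{2,σ₁}` read through
`e_D`, `Polarization.formUnitaryGroupEquivEigenBlocks`, `Polarization.lefschetzGroupBaseChangeEquivTwistedBlocks`) and theorems;
no named fact (net debt `0`).

CARRIER AND HYPOTHESES. `H : HodgeStructure V n`, `Q : Polarization H`, a number field `F` (Milne's `L`!) acting by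
`A : EndAction H F`, an involution `σ` of `F` (Milne's conjugation of `L = F₀[α]` over the centre `F₀`) with the Rosati
condition `hros : Q(ι(a)v, w) = Q(v, ι(σa)w)`, an endomorphism `β ∈ End_ℚ(V)` with `hβF : β ι(a) = ι(σ a) β` ("`αβ = −βα`"),
`hβ2 : β² = ι(b)`, `b ≠ 0` ("`β² = b ∈ F`"), and `hgen : E_φ = ℚ⟨ι(F), β⟩` (`Algebra.adjoin ℚ (insert β (range ι)) = H.endAlg`
— "`E = L·1 ⊕ L·β`"); a field `K ⊇ ℚ` with an injective family `τ : S → Hom(F, K)` of `card S = [F:ℚ]` embeddings, the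
index involution `κ` (`τ (κ s) = τ s ∘ σ`) and a set `Φ ⊆ S` of representatives of its pairs (`hΦ₁`, `hΦ₂`) — for each
`σ₀ : F₀ → K` the pair `{σ₁, σ₂}` of its extensions to `L`, `Φ` picking `σ₁`.

## The source, verbatim

J. S. Milne, *Lefschetz classes on abelian varieties*, Duke Math. J. **96** (1999) 639–675 [Milne1999LefschetzClasses]
(held `paper:doi-10-1215-s0012-7094-99-09620-5`; Duke page = folio + 638), §2 pp. 649–650 (p0011–p0012):
* (type II, p. 649 L19–L33) "In this case `E` is a totally definite quaternion algebra over a totally real field `F`. Therefore,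
  there exists a basis `1, α, β, αβ` for `E` with `α² = a ∈ F`, totally negative, `β² = b ∈ F`, totally negative, `αβ = −βα`.
  Let `D` be an ample divisor on `A` whose Rosati involution is `γ ↦ γ† = αγ′α⁻¹`, and let `φ : V(A) × V(A) → E ⊗_ℚ k` be the
  skew-Hermitian form such that `Tr_{E⊗k/k} ∘ φ = e_D`."
* (p. 649 L55–L64) "Let `L = F[α]`. Then `E = L · 1 ⊕ L · β`, and so we can write `φ(x, y) = φ₁(x, y) + φ₂(x, y)β`,
  `φ₁(x, y), φ₂(x, y) ∈ L ⊗_ℚ k`. Then `φ₁` is a skew-Hermitian form `V × V → L ⊗_ℚ k`, and `φ₂` is a skew-symmetric form. Any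
  `L ⊗_ℚ k`-linear automorphism of `V(A)` fixing `φ₁` and `φ₂` fixes `φ` and is `E ⊗_ℚ k`-linear³, and so
  `Aut_{E⊗k}(V, φ) = Aut_{L⊗k}(V, φ₁) ∩ Aut_{L⊗k}(V, φ₂)`." Footnote 3 (p. 649 L88–L93): "Let `γ : V(A) → V(A)` be an
  `L ⊗ k`-linear automorphism fixing `φ`. Then `φ(βγx, γy) = βφ(γx, γy) = φ(βx, y) = φ(γβx, γy)`, all `x, y ∈ V(A)`, which
  implies that `βγ = γβ`, and hence that `γ` commutes with the action of `L[β] = E`."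
* (p. 650 L1–L21) "`S(A) = ∏ᵢ Res_{Fᵢ/k} U(φ_{1,i}) ∩ Res_{Lᵢ/k} Sp(φ_{2,i})`. Similarly, `S(A)_{/k^al} = ∏_{σ:F→k^al}
  U(φ_{1,σ}) ∩ Sp(φ_{2,σ})`, `(V_σ, φ_{1,σ}, φ_{2,σ}) = (V(A), φ₁, φ₂) ⊗_{F,σ} k^al`. Let `σ₁, σ₂ : L → k^al` be the extensions
  of `σ` to `L`. Then `V_σ = V_{σ₁} ⊕ V_{σ₂}`, `V_{σᵢ} = V ⊗_{L,σᵢ} k^al`, and (see 2.2) `γ ↦ γ|V_{σ₁}` identifies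
  `U(φ_{1,σ}) ∩ Sp(φ_{2,σ})` with `Sp(φ_{2,σ₁})`. The representation of `Sp(φ_{2,σ₁})` on `V_{σ₁}` is its standard representation,
  and its representation on `V_{σ₂}` is the contragredient of the standard representation".
* (type III, p. 650 L26–L36) "This is similar to the preceding case, except that `E = (a,b / F)` with `a ∈ F` totally negative
  (as before) but `b` totally positive, and the ample divisor `D` is chosen so that its Rosati involution is the standard
  involution. Again we let `L = F[α]` […] In this case `β† = −β`, and `S(A) = ∏ᵢ Res U(φ_{1,i}) ∩ Res O(φ_{2,i})` with `φ_{1,i}` a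
  skew-Hermitian form […] and `φ_{2,i}` an `Lᵢ`-bilinear symmetric form. Moreover `S(A)_{k^al} ≅ ∏ O(φ_{2,σ₁})`".

DICTIONARY. On `K`-points, with `Q = e_D = Tr ∘ φ`, the group `U(φ₁)(K)` is `Deligne1982.formUnitaryGroup F K Q.form`
(automorphisms commuting with `L ⊗ K` and fixing `e_D`), and "fixing `φ₂`" is commuting with `β` (§1); on the block `V_{K,σ₁}`
the form `φ_{2,σ₁}` is read through `e_D` as `B_{σ₁}(x, y) = Q_K(x, β_K y)` (`β_K y ∈ V_{K,σ₂}`, and `Q_K` pairs `V_{K,σ₁}` with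
`V_{K,σ₂}` only) — `Polarization.twistedBlockForm`; its parity is `ε · η` for `Q` `ε`-symmetric and `β† = ηβ`
(`Polarization.twistedBlockForm_swap`): alternating for type II (`η = 1`, `ε = −1`: `Sp`), symmetric for type III (`η = −1`: `O`).

## What is PROVED

* §1 `Polarization.lefschetzGroupBaseChange_le_formUnitaryGroup` (`S(H)(K) ≤ U(φ₁)(K)`, for ANY `E_φ ⊇ ι(F)`),
  `Polarization.apply_baseChange_of_mem_lefschetzGroupBaseChange`, **`Polarization.mem_lefschetzGroupBaseChange_iff_mem_formUnitaryGroup_and_comm`**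
  (for `E_φ = ℚ⟨ι(F), β⟩`: `γ ∈ S(H)(K) ⟺ γ ∈ U(φ₁)(K) ∧ γβ_K = β_Kγ` — "`Aut_E(V, φ) = Aut_L(V, φ₁) ∩ Aut_L(V, φ₂)`").
* §2 `EndAction.baseChange_apply_mem_eigenspaceBaseChange_comp` (**`β_K V_{K,χ} ⊆ V_{K,χ∘σ}`**),
  `EndAction.baseChange_baseChange_apply_of_mul_self_eq`, `EndAction.baseChange_injective_of_mul_self_eq`.
* §3 DEF `Polarization.twistedBlockForm K A β χ` (`B_χ(x, y) = Q_K(x, β_K y)` on `V_{K,χ}`), `_apply`,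
  **`Polarization.twistedBlockForm_swap`** (`B(y, x) = (-1)ⁿ η B(x, y)` when `Q(βv, w) = η Q(v, βw)`).
* §4 DEF `Polarization.formUnitaryGroupEquivEigenBlocks` (`U(φ₁)(K) ≃* ∏_{s ∈ Φ} GL(V_{K,τₛ})`, g21-#1 transported; `coe_…_apply`),
  `Polarization.formUnitaryGroupEquivEigenBlocks_mem_isometryCentralizer` (blocks of `γ ∈ S(H)(K)` preserve `B`),
  `Polarization.apply_mem_eigenspaceBaseChange_of_mem_formUnitaryGroup`, the converse in three steps
  `Polarization.apply_baseChange_eq_of_mem_formUnitaryGroup_of_mem` (on a representative block, by the PERFECT pairing of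
  FILE 2 — Milne's footnote 3), `…_of_mem_partner` (on the partner block, by `β² = ι(b)`), `Polarization.apply_baseChange_eq_of_mem_formUnitaryGroup`
  (on `K ⊗ V = ⊕ V_{K,τₜ}`); DEF **`Polarization.lefschetzGroupBaseChangeEquivTwistedBlocks :
  S(H)(K) ≃* ∏_{s ∈ Φ} Aut(V_{K,τₛ}, B_{τₛ})`** with `Aut(W, B) = MatrixAlgAction.isometryCentralizer ∅ B` of
  `LinearAlgebra/Matrix/MatrixAlgebraModuleCorner` (it IS restriction: `coe_…_apply`), and
  `Polarization.exists_unique_mem_lefschetzGroupBaseChange_restrict_eq_of_twisted` (every family of `B`-isometries of the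
  representative blocks is the family of blocks of a unique `γ ∈ S(H)(K)`).
* §5 `EndAction.bijective_restrict_baseChange` (**`β_K : V_{K,τₛ} ⥲ V_{K,τₛ∘σ}`**), **`Polarization.twistedBlockForm_nondegenerate`**.

NOT here (honest): that `E_φ` of a type II / III abelian variety HAS this shape (Albert's classification, the basis `1, α, β, αβ`,
the choice of the ample divisor making the Rosati involution `γ ↦ αγ′α⁻¹` resp. standard — hypotheses `hβF`, `hβ2`, `hgen`,
`hros`, `hβadj` here); the `E ⊗ k`-valued `φ` and its components `φ₁`, `φ₂` themselves (the tree's `Motives/HodgeStructureLefschetzGroupTraceTransfer`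
constructs `φ₁` for a FIELD; `φ₂` appears only through `B = Q_K(·, β·)`); the rational structure `∏ᵢ Res_{Fᵢ/k}` over a non-split
`k`; the identification of `Aut(V_{K,σ₁}, B)` with a split `Sp_{2m}` / `O_m` by a choice of basis; type IV with `d > 1` (Morita,
`LinearAlgebra/Matrix/MatrixAlgebraModuleCorner` BY NAME). HC is NOT proved; nothing here claims a case of the Hodge conjecture.

## References

* [Milne1999LefschetzClasses] J. S. Milne, *Lefschetz classes on abelian varieties*, Duke Math. J. 96 (1999) 639–675 — §1 p. 644,
  §2 Remark 2.2 (pp. 647–648), pp. 649–650 (types II and III, footnote 3).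
* [Deligne1982HodgeCycles] P. Deligne, *Hodge cycles on abelian varieties*, LNM 900 (1982) — §4 (the decomposition
  `H¹_B ⊗ ℂ = ⊕_σ H¹_{B,σ}` along the action of a field; proof of Lemma 4.6).
-/

noncomputable section

open scoped TensorProduct
open Function Module

namespace Literature.AlgebraicGeometry.Motives

namespace HodgeStructure

open Literature.LinearAlgebra.Matrix (MatrixAlgAction.isometryCentralizer MatrixAlgAction.mem_isometryCentralizer_empty_iff)

universe u uK

variable {V : Type u} [AddCommGroup V] [Module ℚ V] {n : ℤ} {H : HodgeStructure V n}
variable {F : Type*} [Field F] [NumberField F]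
variable (K : Type uK) [Field K] [Algebra ℚ K] (A : EndAction H F) {S : Type*} (τ : S → (F →ₐ[ℚ] K))
variable (Q : Polarization H) (σ : F ≃ₐ[ℚ] F) (β : Module.End ℚ V)

/-! ## §1 `S(H)(K) ⊆ U(K)` and the criterion "`γ ∈ S(H)(K)` iff `γ ∈ U(K)` and `γβ = βγ`" for `E_φ = ⟨ι(F), β⟩` -/

/-- **`S(H)(K) ≤ U(φ₁)(K)`**: an element of the Lefschetz group commutes with `ι(F) ⊗ K ⊆ E_φ ⊗ K` and preserves `Q_K`
(Milne: `S(A) = U(φ₁) ∩ Sp(φ₂)` — the first intersectand). [cite: Milne1999LefschetzClasses, §2 p. 650 L9–L12 ("S(A) = ∏ Res U(φ_{1,i}) ∩ Res Sp(φ_{2,i})")] -/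
theorem Polarization.lefschetzGroupBaseChange_le_formUnitaryGroup :
    letI : Module F V := Module.compHom V (A.ι : F →+* Module.End ℚ V)
    haveI : IsScalarTower ℚ F V := A.isScalarTower_compHom
    Q.lefschetzGroupBaseChange K ≤ Deligne1982.formUnitaryGroup F K Q.form := by
  letI : Module F V := Module.compHom V (A.ι : F →+* Module.End ℚ V)
  haveI : IsScalarTower ℚ F V := A.isScalarTower_compHom
  intro γ hγ
  rw [Q.mem_lefschetzGroupBaseChange_iff] at hγ
  rw [Deligne1982.mem_formUnitaryGroup_iff]
  refine ⟨fun a x => ?_, hγ.2⟩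
  rw [A.actL_eq_baseChange_ι K a]
  exact (hγ.1 ⟨A.ι a, A.map_F_le a⟩ x).symm

/-- An element of `S(H)(K)` commutes with `β_K` for every `β ∈ E_φ`. [cite: Milne1999LefschetzClasses, §1 p. 644 L18 ("S(A)(R) = {γ ∈ C(A) ⊗_k R | γ†γ = 1}")] -/
theorem Polarization.apply_baseChange_of_mem_lefschetzGroupBaseChange (hβ : β ∈ H.endAlg)
    {γ : (K ⊗[ℚ] V) ≃ₗ[K] (K ⊗[ℚ] V)} (hγ : γ ∈ Q.lefschetzGroupBaseChange K) (x : K ⊗[ℚ] V) :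
    γ (β.baseChange K x) = β.baseChange K (γ x) :=
  (((Q.mem_lefschetzGroupBaseChange_iff (K := K) γ).1 hγ).1 ⟨β, hβ⟩ x).symm

/-- The operators whose base change to `K` commutes with a given `γ` form a `ℚ`-subalgebra of `End_ℚ(V)` (private plumbing).
[folklore] -/
private def commSubalgebra (γ : (K ⊗[ℚ] V) ≃ₗ[K] (K ⊗[ℚ] V)) : Subalgebra ℚ (Module.End ℚ V) where
  carrier := {a | ∀ x, γ (a.baseChange K x) = a.baseChange K (γ x)}
  mul_mem' {a b} ha hb x := by
    rw [LinearMap.baseChange_mul, Module.End.mul_apply, Module.End.mul_apply, ha, hb]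
  one_mem' x := by rw [LinearMap.baseChange_one]; rfl
  add_mem' {a b} ha hb x := by
    rw [LinearMap.baseChange_add, LinearMap.add_apply, LinearMap.add_apply, map_add, ha, hb]
  zero_mem' x := by simp [LinearMap.baseChange_zero]
  algebraMap_mem' c x := by
    rw [Algebra.algebraMap_eq_smul_one, LinearMap.baseChange_smul, LinearMap.baseChange_one]
    change γ (c • x) = c • γ x
    rw [← algebraMap_smul K c x, ← algebraMap_smul K c (γ x), map_smul]

/-- **`γ ∈ S(H)(K)` iff `γ ∈ U(φ₁)(K)` and `γ β_K = β_K γ`**, when `E_φ` is generated by `ι(F)` and `β` (Milne for a quaternion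
algebra `E = L·1 ⊕ L·β`: "any `L ⊗ k`-linear automorphism fixing `φ₁` and `φ₂` fixes `φ` and is `E ⊗ k`-linear", footnote 3:
"which implies that `βγ = γβ`, and hence that `γ` commutes with the action of `L[β] = E`").
[cite: Milne1999LefschetzClasses, §2 p. 649 L60–L64 and footnote 3 (p. 649)] -/
theorem Polarization.mem_lefschetzGroupBaseChange_iff_mem_formUnitaryGroup_and_comm
    (hgen : Algebra.adjoin ℚ (insert β (Set.range A.ι)) = H.endAlg) (γ : (K ⊗[ℚ] V) ≃ₗ[K] (K ⊗[ℚ] V)) :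
    letI : Module F V := Module.compHom V (A.ι : F →+* Module.End ℚ V)
    haveI : IsScalarTower ℚ F V := A.isScalarTower_compHom
    γ ∈ Q.lefschetzGroupBaseChange K ↔
      γ ∈ Deligne1982.formUnitaryGroup F K Q.form ∧ ∀ x, γ (β.baseChange K x) = β.baseChange K (γ x) := by
  letI : Module F V := Module.compHom V (A.ι : F →+* Module.End ℚ V)
  haveI : IsScalarTower ℚ F V := A.isScalarTower_compHom
  have hβ : β ∈ H.endAlg := by
    rw [← hgen]; exact Algebra.subset_adjoin (Set.mem_insert β _)
  refine ⟨fun hγ => ⟨Q.lefschetzGroupBaseChange_le_formUnitaryGroup K A hγ,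
    Q.apply_baseChange_of_mem_lefschetzGroupBaseChange K β hβ hγ⟩, fun ⟨hU, hβγ⟩ => ?_⟩
  rw [Deligne1982.mem_formUnitaryGroup_iff] at hU
  rw [Q.mem_lefschetzGroupBaseChange_iff]
  refine ⟨fun a x => ?_, hU.2⟩
  -- `E_φ = adjoin (ι(F) ∪ {β})` lies in the subalgebra of operators whose base change commutes with `γ`
  have hle : H.endAlg ≤ commSubalgebra K γ := by
    rw [← hgen]
    refine Algebra.adjoin_le ?_
    rintro b (rfl | ⟨c, rfl⟩)
    · exact hβγ
    · intro x
      have h := hU.1 c x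
      rw [A.actL_eq_baseChange_ι K c] at h
      exact h
  exact (hle a.2 x).symm

/-! ## §2 `β` permutes the blocks: `β_K(V_{K,χ}) ⊆ V_{K,χ∘σ}` when `βι(a) = ι(σa)β` -/

/-- **`β_K` maps `V_{K,χ}` into `V_{K,χ∘σ}`** for `β` with `β ι(a) = ι(σ a) β` and `σ² = 1` (Milne: `β` interchanges the two
summands `V_σ = V_{σ₁} ⊕ V_{σ₂}`, "`αβ = −βα`"). [cite: Milne1999LefschetzClasses, §2 p. 649 L21–L26 ("αβ = −βα") and p. 650 L17–L19 ("V_σ = V_{σ₁} ⊕ V_{σ₂}")] -/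
theorem EndAction.baseChange_apply_mem_eigenspaceBaseChange_comp (hβF : ∀ a, β * A.ι a = A.ι (σ a) * β)
    (hσ : ∀ a, σ (σ a) = a) {χ : F →ₐ[ℚ] K} {x : K ⊗[ℚ] V} (hx : x ∈ A.eigenspaceBaseChange K χ) :
    β.baseChange K x ∈ A.eigenspaceBaseChange K (χ.comp (σ : F →ₐ[ℚ] F)) := by
  rw [A.mem_eigenspaceBaseChange_iff K] at hx ⊢
  intro a
  have h : A.ι a * β = β * A.ι (σ a) := by rw [hβF (σ a), hσ]
  rw [← Module.End.mul_apply, ← LinearMap.baseChange_mul, h, LinearMap.baseChange_mul, Module.End.mul_apply, hx (σ a),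
    LinearMap.map_smul_of_tower]
  rfl

/-- `β_K ∘ β_K = ι(b)_K` when `β² = ι(b)`. [cite: Milne1999LefschetzClasses, §2 p. 649 L22–L24 ("β² = b ∈ F")] -/
theorem EndAction.baseChange_baseChange_apply_of_mul_self_eq {b : F} (hβ2 : β * β = A.ι b) (x : K ⊗[ℚ] V) :
    β.baseChange K (β.baseChange K x) = (A.ι b).baseChange K x := by
  rw [← Module.End.mul_apply, ← LinearMap.baseChange_mul, hβ2]

/-- `β_K` is injective when `β² = ι(b)` with `b ≠ 0`. [cite: Milne1999LefschetzClasses, §2 p. 649 L22–L24 ("β² = b ∈ F, totally negative")] -/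
theorem EndAction.baseChange_injective_of_mul_self_eq {b : F} (hb : b ≠ 0) (hβ2 : β * β = A.ι b) :
    Function.Injective (β.baseChange K) := by
  intro x y hxy
  have h := congr_arg (fun z => (A.ι b⁻¹).baseChange K (β.baseChange K z)) hxy
  simp only [A.baseChange_baseChange_apply_of_mul_self_eq K β hβ2, ← Module.End.mul_apply, ← LinearMap.baseChange_mul,
    ← map_mul, inv_mul_cancel₀ hb, map_one, LinearMap.baseChange_one, Module.End.one_apply] at h
  exact h

/-! ## §3 The twisted block forms `B_χ(x, y) = Q_K(x, β_K y)` on `V_{K,χ}` (Milne's `φ_{2,σ₁}`) -/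

/-- **`B_χ(x, y) = Q_K(x, β_K y)` on the block `V_{K,χ}`** — the bilinear form whose automorphism group is Milne's
`Sp(φ_{2,σ₁})` (type II) / `O(φ_{2,σ₁})` (type III): for `φ = φ₁ + φ₂β`, the `β`-component `φ₂` read on `V_{σ₁}` through
`e_D = Tr ∘ φ`. [cite: Milne1999LefschetzClasses, §2 p. 649 L57–L59 ("φ(x, y) = φ₁(x, y) + φ₂(x, y)β") and p. 650 L20–L21 ("identifies U(φ_{1,σ}) ∩ Sp(φ_{2,σ}) with Sp(φ_{2,σ₁})")] -/
def Polarization.twistedBlockForm (χ : F →ₐ[ℚ] K) : LinearMap.BilinForm K (A.eigenspaceBaseChange K χ) :=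
  (Q.form.baseChange K).compl₁₂ (A.eigenspaceBaseChange K χ).subtype (β.baseChange K ∘ₗ (A.eigenspaceBaseChange K χ).subtype)

/-- `B_χ(x, y) = Q_K(x, β_K y)`. [cite: Milne1999LefschetzClasses, §2 p. 649 L57–L59] -/
@[simp] theorem Polarization.twistedBlockForm_apply (χ : F →ₐ[ℚ] K) (x y : A.eigenspaceBaseChange K χ) :
    Q.twistedBlockForm K A β χ x y = Q.form.baseChange K (x : K ⊗[ℚ] V) (β.baseChange K (y : K ⊗[ℚ] V)) :=
  rfl

/-- **Parity of `B_χ`**: if `Q` is `ε`-symmetric (`ε = (-1)ⁿ`) and `β† = ηβ` (`Q(βv, w) = η Q(v, βw)`), then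
`B_χ(y, x) = ε η B_χ(x, y)` — type II (`β† = β`, `ε = −1`): `B_χ` alternating, "`Sp(φ_{2,σ₁})`"; type III (`β† = −β`):
`B_χ` symmetric, "`O(φ_{2,σ₁})`". [cite: Milne1999LefschetzClasses, §2 p. 650 L20–L21 (type II, "Sp(φ_{2,σ₁})") and L28–L33 (type III, "In this case β† = −β … O(φ_{2,σ₁})")] -/
theorem Polarization.twistedBlockForm_swap {η : ℚ} (hβadj : ∀ v w, Q.form (β v) w = η * Q.form v (β w))
    (χ : F →ₐ[ℚ] K) (x y : A.eigenspaceBaseChange K χ) :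
    Q.twistedBlockForm K A β χ y x =
      algebraMap ℚ K ((((n.negOnePow : ℤˣ) : ℤ) : ℚ) * η) * Q.twistedBlockForm K A β χ x y := by
  rw [Q.twistedBlockForm_apply K, Q.twistedBlockForm_apply K]
  -- `Q_K(y, βx) = ε Q_K(βx, y) = ε η Q_K(x, βy)`
  have hswap : ∀ v w : K ⊗[ℚ] V, Q.form.baseChange K w v =
      algebraMap ℚ K (((n.negOnePow : ℤˣ) : ℤ) : ℚ) * Q.form.baseChange K v w := by
    intro v w
    induction v using TensorProduct.induction_on with
    | zero => simp
    | tmul c v =>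
      induction w using TensorProduct.induction_on with
      | zero => simp
      | tmul d w =>
        simp only [LinearMap.BilinForm.baseChange_tmul, Q.form_swap_eq_negOnePow_mul v w, Algebra.smul_def, map_mul]
        ring
      | add w₁ w₂ h₁ h₂ => simp only [map_add, LinearMap.add_apply, h₁, h₂, mul_add]
    | add v₁ v₂ h₁ h₂ => simp only [map_add, LinearMap.add_apply, h₁, h₂, mul_add]
  have hadj : ∀ v w : K ⊗[ℚ] V, Q.form.baseChange K (β.baseChange K v) w =
      algebraMap ℚ K η * Q.form.baseChange K v (β.baseChange K w) := by
    intro v w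
    induction v using TensorProduct.induction_on with
    | zero => simp
    | tmul c v =>
      induction w using TensorProduct.induction_on with
      | zero => simp
      | tmul d w =>
        simp only [LinearMap.baseChange_tmul, LinearMap.BilinForm.baseChange_tmul, hβadj v w, Algebra.smul_def, map_mul]
        ring
      | add w₁ w₂ h₁ h₂ => simp only [map_add, h₁, h₂, mul_add]
    | add v₁ v₂ h₁ h₂ => simp only [map_add, LinearMap.add_apply, h₁, h₂, mul_add]
  rw [hswap, hadj, ← mul_assoc, ← map_mul]


/-! ## §4 `S(H)(K) ≃* ∏_{s ∈ Φ} Aut(V_{K,τₛ}, B_{τₛ})` by restriction — Milne's "`γ ↦ γ|V_{σ₁}` identifies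
`U(φ_{1,σ}) ∩ Sp(φ_{2,σ})` with `Sp(φ_{2,σ₁})`" for every pair, assembled over a set `Φ` of representatives -/

section Splitting

variable [Fintype S] [Module.Finite ℚ V] (κ : S → S) (Φ : Finset S)
variable (hτ : Injective τ) (hcard : Fintype.card S = finrank ℚ F)
  (hros : ∀ a v w, Q.form (A.ι a v) w = Q.form v (A.ι (σ a) w)) (hσ : ∀ a, σ (σ a) = a)
  (hκ : ∀ s, τ (κ s) = (τ s).comp (σ : F →ₐ[ℚ] F))
  (hΦ₁ : ∀ s, s ∈ Φ ∨ κ s ∈ Φ) (hΦ₂ : ∀ s ∈ Φ, κ s ∉ Φ)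

/-- **`U(φ₁)(K) ≃* ∏_{s ∈ Φ} GL(V_{K,τₛ})` by restriction** (g21-#1's `formUnitaryGroupEquiv` with the blocks typed as the
tree's `A.eigenspaceBaseChange K (τ s)`; the construction of `Polarization.lefschetzGroupBaseChangeEquivEigenBlocks` WITHOUT the
hypothesis `E_φ = ι(F)`). [cite: Milne1999LefschetzClasses, §2 Remark 2.2 (p. 647 L69 – p. 648 L5)] -/
def Polarization.formUnitaryGroupEquivEigenBlocks :
    letI : Module F V := Module.compHom V (A.ι : F →+* Module.End ℚ V)
    haveI : IsScalarTower ℚ F V := A.isScalarTower_compHom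
    Deligne1982.formUnitaryGroup F K Q.form ≃*
      ∀ s : Φ, A.eigenspaceBaseChange K (τ s) ≃ₗ[K] A.eigenspaceBaseChange K (τ s) :=
  letI : Module F V := Module.compHom V (A.ι : F →+* Module.End ℚ V)
  haveI : IsScalarTower ℚ F V := A.isScalarTower_compHom
  (Deligne1982.formUnitaryGroupEquiv τ (σ : F →ₐ[ℚ] F) κ Q.form Φ (traceForm_nondegenerate ℚ F) hros hτ hcard hκ hσ
      Q.nondegenerate Q.form_swap_eq_negOnePow_mul hΦ₁ hΦ₂).trans
    (MulEquiv.piCongrRight fun s =>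
      glConjMulEquiv (LinearEquiv.ofEq _ _ (A.weightSpace_eq_eigenspaceBaseChange K τ (s : S))))

/-- The isomorphism IS restriction: `(equiv u s) x = u x`. [cite: Milne1999LefschetzClasses, §2 Remark 2.2 (p. 647 L69 – p. 648 L5)] -/
theorem Polarization.coe_formUnitaryGroupEquivEigenBlocks_apply
    (u : letI : Module F V := Module.compHom V (A.ι : F →+* Module.End ℚ V)
      haveI : IsScalarTower ℚ F V := A.isScalarTower_compHom
      Deligne1982.formUnitaryGroup F K Q.form)
    (s : Φ) (x : A.eigenspaceBaseChange K (τ s)) :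
    ((Q.formUnitaryGroupEquivEigenBlocks K A τ σ κ Φ hτ hcard hros hσ hκ hΦ₁ hΦ₂ u s x : A.eigenspaceBaseChange K (τ s)) :
        K ⊗[ℚ] V) = (u : (K ⊗[ℚ] V) ≃ₗ[K] (K ⊗[ℚ] V)) x :=
  rfl

variable (hβF : ∀ a, β * A.ι a = A.ι (σ a) * β) {b : F} (hb : b ≠ 0) (hβ2 : β * β = A.ι b)
  (hgen : Algebra.adjoin ℚ (insert β (Set.range A.ι)) = H.endAlg)

/-- **`γ|V_{K,τₛ}` preserves `B_{τₛ}` for `γ ∈ S(H)(K)`** (`Q_K(γx, βγy) = Q_K(γx, γβy) = Q_K(x, βy)`: "fixing `φ₁` and `φ₂`").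
[cite: Milne1999LefschetzClasses, §2 p. 650 L17–L21 ("γ ↦ γ|V_{σ₁} identifies U(φ_{1,σ}) ∩ Sp(φ_{2,σ}) with Sp(φ_{2,σ₁})")] -/
theorem Polarization.formUnitaryGroupEquivEigenBlocks_mem_isometryCentralizer (hβ : β ∈ H.endAlg)
    (γ : Q.lefschetzGroupBaseChange K) (s : Φ) :
    Q.formUnitaryGroupEquivEigenBlocks K A τ σ κ Φ hτ hcard hros hσ hκ hΦ₁ hΦ₂
        ⟨γ, Q.lefschetzGroupBaseChange_le_formUnitaryGroup K A γ.2⟩ s ∈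
      MatrixAlgAction.isometryCentralizer (L := K) (W := A.eigenspaceBaseChange K (τ s))
        (∅ : Set (Module.End K (A.eigenspaceBaseChange K (τ s)))) (Q.twistedBlockForm K A β (τ s)) := by
  rw [MatrixAlgAction.mem_isometryCentralizer_empty_iff]
  intro x y
  rw [Q.twistedBlockForm_apply K, Q.twistedBlockForm_apply K,
    Q.coe_formUnitaryGroupEquivEigenBlocks_apply K A τ σ κ Φ hτ hcard hros hσ hκ hΦ₁ hΦ₂,
    Q.coe_formUnitaryGroupEquivEigenBlocks_apply K A τ σ κ Φ hτ hcard hros hσ hκ hΦ₁ hΦ₂,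
    ← Q.apply_baseChange_of_mem_lefschetzGroupBaseChange K β hβ γ.2]
  exact ((Q.mem_lefschetzGroupBaseChange_iff (K := K) (γ : (K ⊗[ℚ] V) ≃ₗ[K] (K ⊗[ℚ] V))).1 γ.2).2 _ _

omit [Fintype S] [Module.Finite ℚ V] in
/-- An element of `U(φ₁)(K)` preserves every block `V_{K,τₜ}`. [cite: Milne1999LefschetzClasses, §2 p. 646 L50–L52 ("α = α₁ ⊕ ⋯ ⊕ α_t")] -/
theorem Polarization.apply_mem_eigenspaceBaseChange_of_mem_formUnitaryGroup
    {u : (K ⊗[ℚ] V) ≃ₗ[K] (K ⊗[ℚ] V)}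
    (hu : letI : Module F V := Module.compHom V (A.ι : F →+* Module.End ℚ V)
      haveI : IsScalarTower ℚ F V := A.isScalarTower_compHom
      u ∈ Deligne1982.formUnitaryGroup F K Q.form)
    (χ : F →ₐ[ℚ] K) {x : K ⊗[ℚ] V} (hx : x ∈ A.eigenspaceBaseChange K χ) : u x ∈ A.eigenspaceBaseChange K χ := by
  letI : Module F V := Module.compHom V (A.ι : F →+* Module.End ℚ V)
  haveI : IsScalarTower ℚ F V := A.isScalarTower_compHom
  refine A.apply_mem_eigenspaceBaseChange_of_comm K (γ := (u : Module.End K (K ⊗[ℚ] V))) (fun a y => ?_) hx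
  have h := ((Deligne1982.mem_formUnitaryGroup_iff Q.form u).1 hu).1 a y
  rw [A.actL_eq_baseChange_ι K a] at h
  exact h

section Converse

include hτ hcard hros hσ hκ hβF

/-- **The converse on a representative block**: if `u ∈ U(φ₁)(K)` and `u|V_{K,τₛ}` preserves `B_{τₛ}` (`s ∈ Φ`), then
`uβ = βu` on `V_{K,τₛ}` — pair `uβy − βuy ∈ V_{K,τₛ∘σ}` against `V_{K,τₛ} = u(V_{K,τₛ})` with the PERFECT pairing `Q_K`
(Milne's "`φ(βγx, γy) = βφ(γx, γy) = φ(βx, y) = φ(γβx, γy)` … which implies that `βγ = γβ`").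
[cite: Milne1999LefschetzClasses, §2 p. 649 footnote 3 and Remark 2.2 (p. 647 L48 – p. 648 L7)] -/
theorem Polarization.apply_baseChange_eq_of_mem_formUnitaryGroup_of_mem {u : (K ⊗[ℚ] V) ≃ₗ[K] (K ⊗[ℚ] V)}
    (hu : letI : Module F V := Module.compHom V (A.ι : F →+* Module.End ℚ V)
      haveI : IsScalarTower ℚ F V := A.isScalarTower_compHom
      u ∈ Deligne1982.formUnitaryGroup F K Q.form)
    {s : S} (hB : ∀ x ∈ A.eigenspaceBaseChange K (τ s), ∀ y ∈ A.eigenspaceBaseChange K (τ s),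
      Q.form.baseChange K (u x) (β.baseChange K (u y)) = Q.form.baseChange K x (β.baseChange K y))
    (hsurj : ∀ x ∈ A.eigenspaceBaseChange K (τ s), ∃ x₀ ∈ A.eigenspaceBaseChange K (τ s), u x₀ = x)
    {y : K ⊗[ℚ] V} (hy : y ∈ A.eigenspaceBaseChange K (τ s)) :
    u (β.baseChange K y) = β.baseChange K (u y) := by
  letI : Module F V := Module.compHom V (A.ι : F →+* Module.End ℚ V)
  haveI : IsScalarTower ℚ F V := A.isScalarTower_compHom
  have hperf := Q.isPerfPair_baseChange_form_eigenspaceBaseChange K A τ σ κ hτ hcard hros hσ hκ s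
  -- both `u(βy)` and `β(uy)` lie in the partner block `V_{K,τₛ∘σ}`
  have hβy : β.baseChange K y ∈ A.eigenspaceBaseChange K ((τ s).comp (σ : F →ₐ[ℚ] F)) :=
    A.baseChange_apply_mem_eigenspaceBaseChange_comp K σ β hβF hσ hy
  have h1 : u (β.baseChange K y) ∈ A.eigenspaceBaseChange K ((τ s).comp (σ : F →ₐ[ℚ] F)) :=
    Q.apply_mem_eigenspaceBaseChange_of_mem_formUnitaryGroup K A hu _ hβy
  have h2 : β.baseChange K (u y) ∈ A.eigenspaceBaseChange K ((τ s).comp (σ : F →ₐ[ℚ] F)) :=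
    A.baseChange_apply_mem_eigenspaceBaseChange_comp K σ β hβF hσ
      (Q.apply_mem_eigenspaceBaseChange_of_mem_formUnitaryGroup K A hu _ hy)
  -- `Q_K(x, uβy − βuy) = 0` for every `x ∈ V_{K,τₛ}`
  have hzero : ∀ x ∈ A.eigenspaceBaseChange K (τ s),
      Q.form.baseChange K x (u (β.baseChange K y) - β.baseChange K (u y)) = 0 := by
    intro x hx
    obtain ⟨x₀, hx₀, rfl⟩ := hsurj x hx
    have hiso := ((Deligne1982.mem_formUnitaryGroup_iff Q.form u).1 hu).2 x₀ (β.baseChange K y)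
    rw [map_sub, hiso, hB x₀ hx₀ y hy, sub_self]
  -- perfect pairing: the right map `V_{K,τₛ∘σ} → Dual V_{K,τₛ}` is injective
  set d : A.eigenspaceBaseChange K ((τ s).comp (σ : F →ₐ[ℚ] F)) :=
    ⟨u (β.baseChange K y) - β.baseChange K (u y), Submodule.sub_mem _ h1 h2⟩ with hd
  have hflip : ((Q.form.baseChange K).compl₁₂ (A.eigenspaceBaseChange K (τ s)).subtype
      (A.eigenspaceBaseChange K ((τ s).comp (σ : F →ₐ[ℚ] F))).subtype).flip d = 0 := by
    refine LinearMap.ext fun x => ?_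
    rw [LinearMap.flip_apply, LinearMap.compl₁₂_apply, Submodule.subtype_apply, Submodule.subtype_apply, hd,
      LinearMap.zero_apply]
    exact hzero x x.2
  have hd0 : d = 0 := hperf.bijective_right.injective (hflip.trans (map_zero _).symm)
  exact sub_eq_zero.1 (congr_arg Subtype.val hd0)

omit [Fintype S] [Module.Finite ℚ V] hτ hcard hros hκ in
include hb hβ2 in
/-- **… and on the partner block** `V_{K,τₜ}` with `τₛ ∘ σ = τₜ` (`βV_{K,τₜ} ⊆ V_{K,τₛ}`, `β² = ι(b)`, `b ≠ 0`, and `u`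
commutes with `ι(b)_K`). [cite: Milne1999LefschetzClasses, §2 p. 649 footnote 3 and L22–L24 ("β² = b ∈ F")] -/
theorem Polarization.apply_baseChange_eq_of_mem_formUnitaryGroup_of_mem_partner {u : (K ⊗[ℚ] V) ≃ₗ[K] (K ⊗[ℚ] V)}
    (hu : letI : Module F V := Module.compHom V (A.ι : F →+* Module.End ℚ V)
      haveI : IsScalarTower ℚ F V := A.isScalarTower_compHom
      u ∈ Deligne1982.formUnitaryGroup F K Q.form)
    {s t : S} (hts : (τ s).comp (σ : F →ₐ[ℚ] F) = τ t)
    (hcomm : ∀ y ∈ A.eigenspaceBaseChange K (τ s), u (β.baseChange K y) = β.baseChange K (u y))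
    {y : K ⊗[ℚ] V} (hy : y ∈ A.eigenspaceBaseChange K (τ t)) :
    u (β.baseChange K y) = β.baseChange K (u y) := by
  letI : Module F V := Module.compHom V (A.ι : F →+* Module.End ℚ V)
  haveI : IsScalarTower ℚ F V := A.isScalarTower_compHom
  have hst : (τ t).comp (σ : F →ₐ[ℚ] F) = τ s := by
    rw [← hts]; exact AlgHom.ext fun a => by simp [hσ a]
  have hβy : β.baseChange K y ∈ A.eigenspaceBaseChange K (τ s) := by
    have h := A.baseChange_apply_mem_eigenspaceBaseChange_comp K σ β hβF hσ hy
    rwa [hst] at h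
  have h := hcomm _ hβy
  -- `u(β²y) = u(ι(b)_K y) = ι(b)_K (u y) = β²(u y)`
  rw [A.baseChange_baseChange_apply_of_mul_self_eq K β hβ2] at h
  have hub : u ((A.ι b).baseChange K y) = (A.ι b).baseChange K (u y) := by
    have h' := ((Deligne1982.mem_formUnitaryGroup_iff Q.form u).1 hu).1 b y
    rw [A.actL_eq_baseChange_ι K b] at h'
    exact h'
  rw [hub, ← A.baseChange_baseChange_apply_of_mul_self_eq K β hβ2] at h
  exact (A.baseChange_injective_of_mul_self_eq K β hb hβ2 h).symm

include hΦ₁ hb hβ2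

/-- **`u ∈ U(φ₁)(K)` whose blocks on `Φ` preserve the `B_{τₛ}` commutes with `β_K`** (blockwise by the two previous lemmas,
then on `K ⊗ V = ⊕ₜ V_{K,τₜ}`). [cite: Milne1999LefschetzClasses, §2 p. 649 footnote 3 ("γ commutes with the action of L[β] = E")] -/
theorem Polarization.apply_baseChange_eq_of_mem_formUnitaryGroup {u : (K ⊗[ℚ] V) ≃ₗ[K] (K ⊗[ℚ] V)}
    (hu : letI : Module F V := Module.compHom V (A.ι : F →+* Module.End ℚ V)
      haveI : IsScalarTower ℚ F V := A.isScalarTower_compHom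
      u ∈ Deligne1982.formUnitaryGroup F K Q.form)
    (hB : ∀ s ∈ Φ, ∀ x ∈ A.eigenspaceBaseChange K (τ s), ∀ y ∈ A.eigenspaceBaseChange K (τ s),
      Q.form.baseChange K (u x) (β.baseChange K (u y)) = Q.form.baseChange K x (β.baseChange K y))
    (hsurj : ∀ s ∈ Φ, ∀ x ∈ A.eigenspaceBaseChange K (τ s), ∃ x₀ ∈ A.eigenspaceBaseChange K (τ s), u x₀ = x)
    (x : K ⊗[ℚ] V) : u (β.baseChange K x) = β.baseChange K (u x) := by
  have hblock : ∀ t, ∀ y ∈ A.eigenspaceBaseChange K (τ t), u (β.baseChange K y) = β.baseChange K (u y) := by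
    intro t
    rcases hΦ₁ t with ht | ht
    · exact fun y hy => Q.apply_baseChange_eq_of_mem_formUnitaryGroup_of_mem K A τ σ β κ hτ hcard hros hσ hκ hβF hu
        (hB t ht) (hsurj t ht) hy
    · have hts : (τ (κ t)).comp (σ : F →ₐ[ℚ] F) = τ t := by
        rw [hκ]; exact AlgHom.ext fun a => by simp [hσ a]
      exact fun y hy => Q.apply_baseChange_eq_of_mem_formUnitaryGroup_of_mem_partner K A τ σ β hσ hβF hb hβ2 hu hts
        (fun y' hy' => Q.apply_baseChange_eq_of_mem_formUnitaryGroup_of_mem K A τ σ β κ hτ hcard hros hσ hκ hβF hu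
          (hB _ ht) (hsurj _ ht) hy') hy
  have h := A.linearMap_eq_of_forall_apply_mem_eq K τ hτ hcard
    (f := (u : Module.End K (K ⊗[ℚ] V)) ∘ₗ β.baseChange K) (g := β.baseChange K ∘ₗ (u : Module.End K (K ⊗[ℚ] V)))
    fun t y hy => by simpa using hblock t y hy
  exact LinearMap.congr_fun h x

end Converse

section Main

include hb hβ2 hβF hgen

/-- **Milne's types II / III on `K`-points: `S(H)(K) ≃* ∏_{s ∈ Φ} Aut(V_{K,τₛ}, B_{τₛ})`, `γ ↦ (γ|V_{K,τₛ})_{s ∈ Φ}`** — for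
`E_φ` generated by `ι(F)` and `β` with `βι(a) = ι(σa)β`, `β² = ι(b)` (`b ≠ 0`), the Rosati condition `Q(ι(a)v, w) = Q(v, ι(σa)w)`,
a field `K` admitting all `[F:ℚ]` embeddings `τₛ`, the index involution `κ` and a set `Φ` of representatives of its pairs:
"`S(A)_{/k^al} = ∏_σ U(φ_{1,σ}) ∩ Sp(φ_{2,σ})` … and `γ ↦ γ|V_{σ₁}` identifies `U(φ_{1,σ}) ∩ Sp(φ_{2,σ})` with `Sp(φ_{2,σ₁})`"
(type II), resp. "`S(A)_{k^al} ≅ ∏ O(φ_{2,σ₁})`" (type III); here `Aut(V_{K,τₛ}, B_{τₛ})` is the full isometry group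
`isometryCentralizer ∅ B_{τₛ}` of `Motives`' sibling `LinearAlgebra/Matrix/MatrixAlgebraModuleCorner`, symplectic or orthogonal
according to `Polarization.twistedBlockForm_swap`. [cite: Milne1999LefschetzClasses, §2 p. 650 L13–L21 (type II) and L28–L36 (type III)] -/
def Polarization.lefschetzGroupBaseChangeEquivTwistedBlocks :
    Q.lefschetzGroupBaseChange K ≃*
      ∀ s : Φ, MatrixAlgAction.isometryCentralizer (L := K) (W := A.eigenspaceBaseChange K (τ s))
        (∅ : Set (Module.End K (A.eigenspaceBaseChange K (τ s)))) (Q.twistedBlockForm K A β (τ s)) :=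
  letI : Module F V := Module.compHom V (A.ι : F →+* Module.End ℚ V)
  haveI : IsScalarTower ℚ F V := A.isScalarTower_compHom
  have hβ : β ∈ H.endAlg := by rw [← hgen]; exact Algebra.subset_adjoin (Set.mem_insert β _)
  let E := Q.formUnitaryGroupEquivEigenBlocks K A τ σ κ Φ hτ hcard hros hσ hκ hΦ₁ hΦ₂
  { toFun := fun γ s => ⟨E ⟨γ, Q.lefschetzGroupBaseChange_le_formUnitaryGroup K A γ.2⟩ s,
      Q.formUnitaryGroupEquivEigenBlocks_mem_isometryCentralizer K A τ σ β κ Φ hτ hcard hros hσ hκ hΦ₁ hΦ₂ hβ γ s⟩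
    invFun := fun g => ⟨(E.symm fun s => (g s : A.eigenspaceBaseChange K (τ s) ≃ₗ[K] A.eigenspaceBaseChange K (τ s))).1, by
      set u := E.symm fun s => (g s : A.eigenspaceBaseChange K (τ s) ≃ₗ[K] A.eigenspaceBaseChange K (τ s)) with hu
      have hEu : ∀ s : Φ, E u s = (g s : _ ≃ₗ[K] _) := fun s => congr_fun (E.apply_symm_apply _) s
      refine (Q.mem_lefschetzGroupBaseChange_iff_mem_formUnitaryGroup_and_comm K A β hgen _).2 ⟨u.2, ?_⟩
      refine Q.apply_baseChange_eq_of_mem_formUnitaryGroup K A τ σ β κ Φ hτ hcard hros hσ hκ hΦ₁ hβF hb hβ2 u.2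
        (fun s hs x hx y hy => ?_) (fun s hs x hx => ?_)
      · -- the block `g s` preserves `B_{τ s}` and IS `u` on `V_{K,τ s}`
        have hg := (MatrixAlgAction.mem_isometryCentralizer_empty_iff _ _).1 (g ⟨s, hs⟩).2 ⟨x, hx⟩ ⟨y, hy⟩
        rw [Q.twistedBlockForm_apply K, Q.twistedBlockForm_apply K, ← hEu ⟨s, hs⟩,
          Q.coe_formUnitaryGroupEquivEigenBlocks_apply K A τ σ κ Φ hτ hcard hros hσ hκ hΦ₁ hΦ₂,
          Q.coe_formUnitaryGroupEquivEigenBlocks_apply K A τ σ κ Φ hτ hcard hros hσ hκ hΦ₁ hΦ₂] at hg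
        exact hg
      · refine ⟨((E u ⟨s, hs⟩).symm ⟨x, hx⟩ : A.eigenspaceBaseChange K (τ s)), Submodule.coe_mem _, ?_⟩
        rw [← Q.coe_formUnitaryGroupEquivEigenBlocks_apply K A τ σ κ Φ hτ hcard hros hσ hκ hΦ₁ hΦ₂ u ⟨s, hs⟩,
          LinearEquiv.apply_symm_apply]⟩
    left_inv := fun γ => Subtype.ext (by
      have h := congr_arg Subtype.val (E.symm_apply_apply ⟨γ, Q.lefschetzGroupBaseChange_le_formUnitaryGroup K A γ.2⟩)
      exact h)
    right_inv := fun g => funext fun s => Subtype.ext (congr_fun (E.apply_symm_apply _) s)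
    map_mul' := fun γ δ => funext fun s => Subtype.ext (by
      have h := congr_fun (map_mul E ⟨γ, Q.lefschetzGroupBaseChange_le_formUnitaryGroup K A γ.2⟩
        ⟨δ, Q.lefschetzGroupBaseChange_le_formUnitaryGroup K A δ.2⟩) s
      rw [Pi.mul_apply] at h
      exact h) }

/-- The isomorphism IS restriction: `((equiv γ) s) x = γ x` on `V_{K,τₛ}`. [cite: Milne1999LefschetzClasses, §2 p. 650 L20 ("γ ↦ γ|V_{σ₁}")] -/
theorem Polarization.coe_lefschetzGroupBaseChangeEquivTwistedBlocks_apply (γ : Q.lefschetzGroupBaseChange K) (s : Φ)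
    (x : A.eigenspaceBaseChange K (τ s)) :
    ((((Q.lefschetzGroupBaseChangeEquivTwistedBlocks K A τ σ β κ Φ hτ hcard hros hσ hκ hΦ₁ hΦ₂ hβF hb hβ2 hgen γ s :
        MatrixAlgAction.isometryCentralizer (L := K) (W := A.eigenspaceBaseChange K (τ s))
          (∅ : Set (Module.End K (A.eigenspaceBaseChange K (τ s)))) (Q.twistedBlockForm K A β (τ s))) :
        A.eigenspaceBaseChange K (τ s) ≃ₗ[K] A.eigenspaceBaseChange K (τ s)) x : A.eigenspaceBaseChange K (τ s)) :
        K ⊗[ℚ] V) = (γ : (K ⊗[ℚ] V) ≃ₗ[K] (K ⊗[ℚ] V)) x :=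
  Q.coe_formUnitaryGroupEquivEigenBlocks_apply K A τ σ κ Φ hτ hcard hros hσ hκ hΦ₁ hΦ₂ _ s x

include hτ hcard hros hσ hκ hΦ₁ hΦ₂ in
/-- **Surjectivity, unbundled**: every family `(g_s)_{s ∈ Φ}` of automorphisms of the blocks `V_{K,τₛ}` preserving the
`B_{τₛ}` is the family of restrictions of a unique `γ ∈ S(H)(K)`. [cite: Milne1999LefschetzClasses, §2 p. 650 L13–L21 and L28–L36] -/
theorem Polarization.exists_unique_mem_lefschetzGroupBaseChange_restrict_eq_of_twisted
    (g : ∀ s : Φ, A.eigenspaceBaseChange K (τ s) ≃ₗ[K] A.eigenspaceBaseChange K (τ s))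
    (hg : ∀ s : Φ, g s ∈ MatrixAlgAction.isometryCentralizer (L := K) (W := A.eigenspaceBaseChange K (τ s))
      (∅ : Set (Module.End K (A.eigenspaceBaseChange K (τ s)))) (Q.twistedBlockForm K A β (τ s))) :
    ∃! γ : Q.lefschetzGroupBaseChange K,
      ∀ (s : Φ) (x : A.eigenspaceBaseChange K (τ s)), (γ : (K ⊗[ℚ] V) ≃ₗ[K] (K ⊗[ℚ] V)) x = g s x := by
  set E := Q.lefschetzGroupBaseChangeEquivTwistedBlocks K A τ σ β κ Φ hτ hcard hros hσ hκ hΦ₁ hΦ₂ hβF hb hβ2 hgen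
  refine ⟨E.symm fun s => ⟨g s, hg s⟩, fun s x => ?_, fun γ hγ => ?_⟩
  · have h := congr_fun (E.apply_symm_apply fun s => ⟨g s, hg s⟩) s
    rw [← Q.coe_lefschetzGroupBaseChangeEquivTwistedBlocks_apply K A τ σ β κ Φ hτ hcard hros hσ hκ hΦ₁ hΦ₂ hβF hb hβ2
      hgen _ s x, h]
  · rw [MulEquiv.eq_symm_apply]
    funext s
    refine Subtype.ext (LinearEquiv.ext fun x => Subtype.ext ?_)
    rw [Q.coe_lefschetzGroupBaseChangeEquivTwistedBlocks_apply K A τ σ β κ Φ hτ hcard hros hσ hκ hΦ₁ hΦ₂ hβF hb hβ2 hgen]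
    exact hγ s x

end Main

/-! ## §5 The twisted block forms are non-degenerate: `β_K : V_{K,τₛ} ⥲ V_{K,τₛ∘σ}` and `Q_K` pairs `V_{K,τₛ}` perfectly
with `V_{K,τₛ∘σ}` ("there is a nondegenerate Ω-bilinear form φ₁ : V₁ × V₂ → Ω") -/

section Nondegenerate

include hτ hcard hros hσ hκ hβF hb hβ2

/-- **`β_K` restricts to a bijection `V_{K,τₛ} → V_{K,τₛ∘σ}`** (injective since `β² = ι(b)`, `b ≠ 0`; the two blocks have the
same dimension, "`V₂ = V₁^∨`"). [cite: Milne1999LefschetzClasses, §2 Remark 2.2 (p. 647 L48 – p. 648 L7) and p. 650 L17–L19] -/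
theorem EndAction.bijective_restrict_baseChange (s : S) :
    Function.Bijective ((β.baseChange K).restrict (p := A.eigenspaceBaseChange K (τ s))
      (q := A.eigenspaceBaseChange K ((τ s).comp (σ : F →ₐ[ℚ] F)))
      fun _ hx => A.baseChange_apply_mem_eigenspaceBaseChange_comp K σ β hβF hσ hx) := by
  have hinj : Function.Injective ((β.baseChange K).restrict (p := A.eigenspaceBaseChange K (τ s))
      (q := A.eigenspaceBaseChange K ((τ s).comp (σ : F →ₐ[ℚ] F)))
      fun _ hx => A.baseChange_apply_mem_eigenspaceBaseChange_comp K σ β hβF hσ hx) := by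
    intro x y hxy
    have h := congr_arg Subtype.val hxy
    simp only [LinearMap.restrict_apply] at h
    exact Subtype.ext (A.baseChange_injective_of_mul_self_eq K β hb hβ2 h)
  refine ⟨hinj, (LinearMap.injective_iff_surjective_of_finrank_eq_finrank (K := K)
    (V := A.eigenspaceBaseChange K (τ s)) (V₂ := A.eigenspaceBaseChange K ((τ s).comp (σ : F →ₐ[ℚ] F))) ?_).1 hinj⟩
  exact A.finrank_eigenspaceBaseChange_eq_finrank_eigenspaceBaseChange_comp K τ Q σ κ hτ hcard hros hσ hκ s

/-- **`B_{τₛ}` is non-degenerate** (both separating): `Q_K(x, βy) = 0` for all `y ∈ V_{K,τₛ}` forces `x = 0` because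
`βV_{K,τₛ} = V_{K,τₛ∘σ}` is perfectly paired with `V_{K,τₛ}`; `Q_K(x, βy) = 0` for all `x` forces `βy = 0`, `y = 0` — Milne's
"`φ_{2,i}` is a (skew-)symmetric form", nondegenerate. [cite: Milne1999LefschetzClasses, §2 Remark 2.2 (p. 647 L51–L52, "nondegenerate Ω-bilinear form φ₁ : V₁ × V₂ → Ω") and p. 650 L13–L21] -/
theorem Polarization.twistedBlockForm_nondegenerate (s : S) : (Q.twistedBlockForm K A β (τ s)).Nondegenerate := by
  have hperf := Q.isPerfPair_baseChange_form_eigenspaceBaseChange K A τ σ κ hτ hcard hros hσ hκ s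
  have hbij := EndAction.bijective_restrict_baseChange K A τ Q σ β κ hτ hcard hros hσ hκ hβF hb hβ2 s
  set βr := (β.baseChange K).restrict (p := A.eigenspaceBaseChange K (τ s))
      (q := A.eigenspaceBaseChange K ((τ s).comp (σ : F →ₐ[ℚ] F)))
      fun _ hx => A.baseChange_apply_mem_eigenspaceBaseChange_comp K σ β hβF hσ hx with hβr
  have hβr_apply : ∀ y : A.eigenspaceBaseChange K (τ s), ((βr y : A.eigenspaceBaseChange K _) : K ⊗[ℚ] V) =
      β.baseChange K (y : K ⊗[ℚ] V) := fun y => by rw [hβr, LinearMap.restrict_apply]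
  refine ⟨fun x hx => ?_, fun y hy => ?_⟩
  · -- left: `Q_K(x, ·)` vanishes on `βV_{K,τₛ} = V_{K,τₛ∘σ}`
    apply hperf.bijective_left.injective
    rw [map_zero]
    refine LinearMap.ext fun z => ?_
    obtain ⟨y, rfl⟩ := hbij.2 z
    rw [LinearMap.compl₁₂_apply, Submodule.subtype_apply, Submodule.subtype_apply, hβr_apply, LinearMap.zero_apply]
    exact hx y
  · -- right: `βy` is `Q_K`-orthogonal to `V_{K,τₛ}`, hence `0`, hence `y = 0`
    have hβy : βr y = 0 := by
      apply hperf.bijective_right.injective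
      rw [map_zero]
      refine LinearMap.ext fun x => ?_
      rw [LinearMap.flip_apply, LinearMap.compl₁₂_apply, Submodule.subtype_apply, Submodule.subtype_apply, hβr_apply,
        LinearMap.zero_apply]
      exact hy x
    exact hbij.1 (hβy.trans (map_zero βr).symm)

end Nondegenerate

end Splitting

end HodgeStructure

end Literature.AlgebraicGeometry.Motives
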